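/-
Copyright (c) 2026. All rights reserved.
Released under Apache 2.0 license as described in the file LICENSE.
Authors: abc-iut cell, seat abc-iut-w5-d206 (gen 5; D-0079 R-C / L-F [AbsTop*]: the COUNTED [AbsTopI] §2 closers
of the lineage's cone node AbsTopI:Thm2.6(iv) INSTANTIATED AT the Def 2.1 (i) GFG construction; proof-only).
-/
import Literature.AnabelianGeometry.AbsoluteAnabelian.AbsTopIProp23GFGAffineModelExtension
import Literature.AnabelianGeometry.AbsoluteAnabelian.AbsTopIAlmostProSigmaConsumersRekey
import HarnessLib

/-!
# [AbsTopI] Thm 2.6 (iv) and its consequences AT the Def 2.1 (i) GFG carrier (zero residual binder)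

S. Mochizuki, *Topics in Absolute Anabelian Geometry I: Generalities* (2012) [AbsTopI] (lit key
`paper:url-11ac98ba15fc`), Def 1.1 (iii) p. 10 (almost pro-`Σ`), Def 2.1 (i) p. 17 (the "GFG-type" construction:
`Δ_X := π₁(X) ⧸ Ker(π₁(Y) ↠ π₁(Y)^Σ)` for a finite Galois covering `Y → X` of a hyperbolic curve, i.e. the maximal
almost pro-`Σ` quotient determined by an open normal subgroup `U ⊴ P` of the profinite completion `P` of the
topological fundamental group), Prop 2.2 p. 18, Thm 2.6 (iv) p. 22 ("every almost pro-omissive topologically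
finitely generated closed normal subgroup of `Π` is contained in `Δ` … if `Σ ≠ 𝔓𝔯𝔦𝔪𝔢𝔰`, `Δ ⊆ Π` may be
characterized group-theoretically"), Thm 2.14 (i) p. 33; and *Topics in Absolute Anabelian Geometry II* (2013)
[AbsTopII] Rmk 3.3.2 p. 69.

PROOF-ONLY file (no definition, no named fact, nothing asserted as an axiom).  The cone node AbsTopI:Thm2.6(iv) is
DISCHARGED of record over an ABSTRACT extension `E : FundamentalExtension` with MLF base by abc-iut-w6-d071's
`FundamentalExtension.MLFBase.thm26iv_of_isAlmostPro (B) (hΔ : E.GeomTFG) (hS : Σ ⊆ 𝔓𝔯𝔦𝔪𝔢𝔰) (hΔS : IsAlmostPro Δ Σ)`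
(p444875, over this lineage's `MLFBase.thm26iv` / `isElastic_absoluteGaloisGroup`, p419653), i.e. modulo the two
printed inputs «Prop 2.2 (`Δ` tfg)» and «Def 2.1 (`Δ` almost pro-`Σ`)» BY NAME.  Both inputs are THEOREMS at the
honest Def 2.1 (i) datum — abc-iut-w6-d030 / abc-iut-w6-d071's `prop22_prop23_gfg_mlf` /
`prop22_prop23_gfg_affine_mlf` (Prop 2.2 at the GFG construction, (FN) a theorem there) and
`GFGSurfaceModel.isAlmostPro` — so the node's closer holds there with **no residual binder at all** (instances
at `Δ` a pro-`Σ` COMPLETION of a f.g. group — the `U = P` case of Def 2.1 (i) — are already in the tree: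
`thm26iv_holds`, `AbsTopIThm26SplitModelInstances.lean`; here `U ⊴ P` is an ARBITRARY open normal subgroup, so `Δ`
is almost pro-`Σ` and in general not pro-`Σ`):

* `MLFBase.thm26iv_gfg_affine` / `MLFBase.thm26iv_gfg_puncturedSurfaceGroup` / `MLFBase.thm26iv_gfg` — the typed
  `E.Thm26iv Σ` for EVERY extension `1 → Δ → Π → G_k → 1` (`k` an MLF) whose `Δ = E.geom` IS the Def 2.1 (i)
  quotient of a pro-`Σ′` completion of a free group of rank `≥ 2` / of `Γ_{g,k+1}` hyperbolic / of a surface group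
  `S_g`, `g ≥ 2` (`Σ ⊆ Σ′`, `Σ ⊆ 𝔓𝔯𝔦𝔪𝔢𝔰` containing a prime), hypotheses = the Def 2.1 (i) DATA only;
* `mem_almostProClass_gfg_affine` / `mem_almostProClass_gfg` — such `E` lie in the almost pro-`Σ` class of
  abc-iut-w6-d071's `AbsTopII.rmk_3_3_2_MLF_of_isAlmostPro` when `Σ ≠ 𝔓𝔯𝔦𝔪𝔢𝔰` (so [AbsTopII] Rmk 3.3.2 holds on the
  class of GFG carriers by `rmk_3_3_2_mono_MLF_of_isAlmostPro`); hence `thm214GroupPart_gfg_affine` — the group part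
  of [AbsTopI] Thm 2.14 (i) for two such extensions `E`, `F` (`Σ, T ⊊ 𝔓𝔯𝔦𝔪𝔢𝔰`) and EVERY `φ : Π_E ⥲ Π_F`, zero
  residual binder (its `PreservesGeom` conjunct at one GFG side is abc-iut-w6-d071's
  `MLFBase.preservesGeom_gfg[_affine]_of_isAlmostPro`, `AbsAnabLem13GFGConstruction.lean` p455731 — not restated);
* `exists_gfg_affine_carrier` — NON-VACUITY of the hypothesis set of the affine theorems at honest data: for every
  prime `p`, every pro-`Σ′` completion `P` of a free group of rank `≥ 2` and every open normal `U ⊴ P`, an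
  extension `E` with MLF base `G = G_{ℚ_p}` and a Def 2.1 (i) presentation `π : P ↠ Δ_E = P ⧸ K_Σ(U)` EXISTS —
  HONEST LABEL: the PRODUCT extension `Δ × G_{ℚ_p}` (trivial outer action; not the arithmetic fundamental group of
  a curve over `ℚ_p`); it certifies joint satisfiability of the binders, nothing more;
  `exists_gfg_affine_carrier_thm26iv` — so `E.Thm26iv Σ` is witnessed at a GFG carrier with `Δ` slim and elastic.

What is NOT claimed: the `Π`-dependent printed inputs of Thm 2.6 (ii)/(iii)/(v) ((∗)_Σ, splitting) are not
theorems of the GFG datum (they depend on the extension class, not on `Δ` alone) and are not touched here; the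
FF/NF weight input `hT` of (i)/(vi) (GAP G-L4t4-1) likewise.  Classical; OUR kernel check; [AbsTopI]/[AbsTopII]
are refereed, undisputed papers; nothing here bears on [IUTchIII] Cor. 3.12; no side is taken; typed ≠ proved.
-/

noncomputable section

open Topology

namespace Literature.AnabelianGeometry.AbsoluteAnabelian

namespace FundamentalExtension

open Literature.AnabelianGeometry.SemiGraphs (IsProSigma)
open Literature.AnabelianGeometry.SemiGraphs.PSCDatum (IsMaxProSigmaQuotient)
open Literature.AnabelianGeometry.SemiGraphs.SemiGraphOfAnabelioids
open Literature.GroupTheory.CombinatorialGroupTheory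
open Literature.GroupTheory.ProfiniteSubquotients
open Literature.Topology.FourManifolds (SurfaceGroup)

/-! ### The almost pro-`Σ` class with MLF base (target of the re-keyed closers) -/

/-- Generic packaging: an extension with MLF base data, `Δ` tfg and almost pro-`Σ` for some `Σ ⊊ 𝔓𝔯𝔦𝔪𝔢𝔰` lies in
the class on which abc-iut-w6-d071's `AbsTopII.rmk_3_3_2_MLF_of_isAlmostPro` acts.
[cite: MochizukiAbsTopI2012, Def 1.1 (iii) p.10] -/
theorem mem_almostProClass_of_isAlmostPro {E : FundamentalExtension.{0}} (B : E.MLFBase) (hΔ : E.GeomTFG)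
    {S : Set ℕ} (hS : S ⊆ {q | q.Prime}) (hS' : S ≠ {q | q.Prime}) (hΔS : IsAlmostPro E.geom S) :
    E ∈ {E : FundamentalExtension.{0} | ∃ _B : E.MLFBase, E.GeomTFG ∧
      ∃ S : Set ℕ, S ⊆ {q | q.Prime} ∧ S ≠ {q | q.Prime} ∧ IsAlmostPro E.geom S} :=
  ⟨B, hΔ, S, hS, hS', hΔS⟩

/-- **"`Δ ⊆ Π` is group-theoretic" on the almost pro-`Σ` class** ([AbsTopI] Thm 2.6 (iv), `Σ ≠ 𝔓𝔯𝔦𝔪𝔢𝔰`): for two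
members `E`, `F`, every `φ : Π_E ⥲ Π_F` carries `Δ_E` onto `Δ_F` (abc-iut-w6-d071's
`AbsTopII.rmk_3_3_2_MLF_of_isAlmostPro`, unfolded). [cite: MochizukiAbsTopI2012, Thm 2.6 (iv) p.22] -/
theorem preservesGeom_of_mem_almostProClass {E F : FundamentalExtension.{0}}
    (hE : E ∈ {E : FundamentalExtension.{0} | ∃ _B : E.MLFBase, E.GeomTFG ∧
      ∃ S : Set ℕ, S ⊆ {q | q.Prime} ∧ S ≠ {q | q.Prime} ∧ IsAlmostPro E.geom S})
    (hF : F ∈ {E : FundamentalExtension.{0} | ∃ _B : E.MLFBase, E.GeomTFG ∧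
      ∃ S : Set ℕ, S ⊆ {q | q.Prime} ∧ S ≠ {q | q.Prime} ∧ IsAlmostPro E.geom S})
    (φ : E.arith ≃ₜ* F.arith) : PreservesGeom φ :=
  AbsTopII.rmk_3_3_2_MLF_of_isAlmostPro E hE F hF φ

/-- **[AbsTopI] Thm 2.14 (i), group part, on the almost pro-`Σ` class.** [cite: MochizukiAbsTopI2012, Thm 2.14 (i) p.33] -/
theorem thm214GroupPart_of_mem_almostProClass {E F : FundamentalExtension.{0}} (B₁ : E.MLFBase) (B₂ : F.MLFBase)
    (hE : E ∈ {E : FundamentalExtension.{0} | ∃ _B : E.MLFBase, E.GeomTFG ∧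
      ∃ S : Set ℕ, S ⊆ {q | q.Prime} ∧ S ≠ {q | q.Prime} ∧ IsAlmostPro E.geom S})
    (hF : F ∈ {E : FundamentalExtension.{0} | ∃ _B : E.MLFBase, E.GeomTFG ∧
      ∃ S : Set ℕ, S ⊆ {q | q.Prime} ∧ S ≠ {q | q.Prime} ∧ IsAlmostPro E.geom S})
    (φ : E.arith ≃ₜ* F.arith) : Thm214GroupPart B₁ B₂ φ :=
  (preservesGeom_of_mem_almostProClass hE hF φ).thm214GroupPart B₁ B₂

/-! ### The affine GFG carrier: `Γ` free of rank `≥ 2` -/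

section Affine

variable {E : FundamentalExtension.{0}} {Sigma Sigma' : Set ℕ} {Γ : Type} [Group Γ] [IsFreeGroup Γ]
  [Finite (IsFreeGroup.Generators Γ)]
  {P : Type} [Group P] [TopologicalSpace P] [IsTopologicalGroup P] [CompactSpace P]
  [TotallyDisconnectedSpace P] {j : Γ →* P} {π : P →* E.geom} {U : Subgroup P}

omit [IsFreeGroup Γ] [Finite (IsFreeGroup.Generators Γ)] [TotallyDisconnectedSpace P] in
/-- **The Def 2.1 (i) quotient `Δ = E.geom` (affine case) is almost pro-`Σ`** — `GFGSurfaceModel.isAlmostPro` at the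
subgroup type `E.geom`. [cite: MochizukiAbsTopI2012, Def 2.1 (i) p.17] -/
theorem isAlmostPro_geom_gfg (hUo : IsOpen (U : Set P)) (hπc : Continuous π)
    (hπs : Function.Surjective π) (hker : π.ker ≤ U) (hmax : IsMaxProSigmaQuotient Sigma (π.subgroupMap U)) :
    IsAlmostPro E.geom Sigma := by
  haveI : CompactSpace E.geom := isCompact_iff_compactSpace.mp E.isClosed_geom.isCompact
  exact GFGSurfaceModel.isAlmostPro hUo hπc hπs hker hmax

/-- **[AbsTopI] Thm 2.6 (iv) AT the affine GFG carrier, zero residual binder**: for an extension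
`1 → Δ → Π → G → 1` with MLF base data whose `Δ = E.geom` IS the Def 2.1 (i) quotient of a pro-`Σ′` completion of
a free group of rank `≥ 2` (`Σ ⊆ Σ′`, `Σ ⊆ 𝔓𝔯𝔦𝔪𝔢𝔰` containing a prime), the typed `E.Thm26iv Σ` HOLDS — Prop 2.2 by
`prop22_prop23_gfg_affine_mlf`, Def 2.1 almost pro-`Σ` by `GFGSurfaceModel.isAlmostPro`, the closer of record
`MLFBase.thm26iv_of_isAlmostPro`. [cite: MochizukiAbsTopI2012, Thm 2.6 (iv) p.22] -/
theorem MLFBase.thm26iv_gfg_affine (B : E.MLFBase) (hn : 2 ≤ Nat.card (IsFreeGroup.Generators Γ))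
    (hSS : Sigma ⊆ Sigma') (hS : ∃ ℓ ∈ Sigma, ℓ.Prime) (hSp : Sigma ⊆ {q | q.Prime})
    (hj : IsProSigmaCompletion Sigma' j) [U.Normal] (hUo : IsOpen (U : Set P)) (hπc : Continuous π)
    (hπs : Function.Surjective π) (hker : π.ker ≤ U) (hmax : IsMaxProSigmaQuotient Sigma (π.subgroupMap U)) :
    E.Thm26iv Sigma :=
  B.thm26iv_of_isAlmostPro (prop22_prop23_gfg_affine_mlf B hn hSS hS (fun _ hp => hSp hp) hj hUo hπc hπs hker hmax).1
    hSp (isAlmostPro_geom_gfg hUo hπc hπs hker hmax)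

/-- The affine GFG carrier with MLF base lies in the almost pro-`Σ` class (`Σ ⊊ 𝔓𝔯𝔦𝔪𝔢𝔰`).
[cite: MochizukiAbsTopI2012, Def 2.1 (i) p.17] -/
theorem mem_almostProClass_gfg_affine (B : E.MLFBase) (hn : 2 ≤ Nat.card (IsFreeGroup.Generators Γ))
    (hSS : Sigma ⊆ Sigma') (hS : ∃ ℓ ∈ Sigma, ℓ.Prime) (hSp : Sigma ⊆ {q | q.Prime})
    (hSne : Sigma ≠ {q | q.Prime}) (hj : IsProSigmaCompletion Sigma' j) [U.Normal] (hUo : IsOpen (U : Set P))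
    (hπc : Continuous π) (hπs : Function.Surjective π) (hker : π.ker ≤ U)
    (hmax : IsMaxProSigmaQuotient Sigma (π.subgroupMap U)) :
    E ∈ {E : FundamentalExtension.{0} | ∃ _B : E.MLFBase, E.GeomTFG ∧
      ∃ S : Set ℕ, S ⊆ {q | q.Prime} ∧ S ≠ {q | q.Prime} ∧ IsAlmostPro E.geom S} :=
  mem_almostProClass_of_isAlmostPro B
    (prop22_prop23_gfg_affine_mlf B hn hSS hS (fun _ hp => hSp hp) hj hUo hπc hπs hker hmax).1 hSp hSne
    (isAlmostPro_geom_gfg hUo hπc hπs hker hmax)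
end Affine

/-! ### Two affine GFG carriers: [AbsTopI] Thm 2.14 (i), group part -/

section TwoAffine

variable {E F : FundamentalExtension.{0}} {Sigma Sigma' T T' : Set ℕ}
  {Γ : Type} [Group Γ] [IsFreeGroup Γ] [Finite (IsFreeGroup.Generators Γ)]
  {Γ₂ : Type} [Group Γ₂] [IsFreeGroup Γ₂] [Finite (IsFreeGroup.Generators Γ₂)]
  {P : Type} [Group P] [TopologicalSpace P] [IsTopologicalGroup P] [CompactSpace P] [TotallyDisconnectedSpace P]
  {P₂ : Type} [Group P₂] [TopologicalSpace P₂] [IsTopologicalGroup P₂] [CompactSpace P₂]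
  [TotallyDisconnectedSpace P₂]
  {j : Γ →* P} {π : P →* E.geom} {U : Subgroup P} {j₂ : Γ₂ →* P₂} {π₂ : P₂ →* F.geom} {U₂ : Subgroup P₂}

/-- **[AbsTopI] Thm 2.14 (i), group part, AT two affine GFG carriers** (`Σ, T ⊊ 𝔓𝔯𝔦𝔪𝔢𝔰`; zero residual binder):
for extensions `E`, `F` with MLF bases whose `Δ`'s are Def 2.1 (i) quotients (affine), EVERY `φ : Π_E ⥲ Π_F` has
`φ(Δ_E) = Δ_F` (the "`Δ ⊆ Π` is group-theoretic" clause of Thm 2.6 (iv); the one-GFG-side form is abc-iut-w6-d071's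
`MLFBase.preservesGeom_gfg_affine_of_isAlmostPro`, p455731), equal residue characteristics, and matching minimal
almost-pro prime sets. [cite: MochizukiAbsTopI2012, Thm 2.14 (i) p.33] -/
theorem thm214GroupPart_gfg_affine (BE : E.MLFBase) (BF : F.MLFBase)
    (hn : 2 ≤ Nat.card (IsFreeGroup.Generators Γ)) (hSS : Sigma ⊆ Sigma') (hS : ∃ ℓ ∈ Sigma, ℓ.Prime)
    (hSp : Sigma ⊆ {q | q.Prime}) (hSne : Sigma ≠ {q | q.Prime}) (hj : IsProSigmaCompletion Sigma' j) [U.Normal]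
    (hUo : IsOpen (U : Set P)) (hπc : Continuous π) (hπs : Function.Surjective π) (hker : π.ker ≤ U)
    (hmax : IsMaxProSigmaQuotient Sigma (π.subgroupMap U))
    (hn₂ : 2 ≤ Nat.card (IsFreeGroup.Generators Γ₂)) (hTT : T ⊆ T') (hT : ∃ ℓ ∈ T, ℓ.Prime)
    (hTp : T ⊆ {q | q.Prime}) (hTne : T ≠ {q | q.Prime}) (hj₂ : IsProSigmaCompletion T' j₂) [U₂.Normal]
    (hUo₂ : IsOpen (U₂ : Set P₂)) (hπc₂ : Continuous π₂) (hπs₂ : Function.Surjective π₂) (hker₂ : π₂.ker ≤ U₂)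
    (hmax₂ : IsMaxProSigmaQuotient T (π₂.subgroupMap U₂)) (φ : E.arith ≃ₜ* F.arith) :
    Thm214GroupPart BE BF φ :=
  thm214GroupPart_of_mem_almostProClass BE BF
    (mem_almostProClass_gfg_affine BE hn hSS hS hSp hSne hj hUo hπc hπs hker hmax)
    (mem_almostProClass_gfg_affine BF hn₂ hTT hT hTp hTne hj₂ hUo₂ hπc₂ hπs₂ hker₂ hmax₂) φ
end TwoAffine

/-! ### The affine GFG carrier over the punctured surface groups `Γ_{g,k+1}` -/

section Punctured

variable {E : FundamentalExtension.{0}} {Sigma Sigma' : Set ℕ} {g k : ℕ}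
  {P : Type} [Group P] [TopologicalSpace P] [IsTopologicalGroup P] [CompactSpace P]
  [TotallyDisconnectedSpace P] {j : PuncturedSurfaceGroup g (k + 1) →* P} {π : P →* E.geom} {U : Subgroup P}

/-- **[AbsTopI] Thm 2.6 (iv) AT the GFG carrier over `Γ_{g,k+1}`** (hyperbolic affine type `2g − 2 + (k+1) > 0`),
zero residual binder. [cite: MochizukiAbsTopI2012, Thm 2.6 (iv) p.22] -/
theorem MLFBase.thm26iv_gfg_puncturedSurfaceGroup (B : E.MLFBase)
    (hgk : PuncturedSurfaceGroup.IsHyperbolicType g (k + 1)) (hSS : Sigma ⊆ Sigma') (hS : ∃ ℓ ∈ Sigma, ℓ.Prime)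
    (hSp : Sigma ⊆ {q | q.Prime}) (hj : IsProSigmaCompletion Sigma' j) [U.Normal] (hUo : IsOpen (U : Set P))
    (hπc : Continuous π) (hπs : Function.Surjective π) (hker : π.ker ≤ U)
    (hmax : IsMaxProSigmaQuotient Sigma (π.subgroupMap U)) : E.Thm26iv Sigma := by
  obtain ⟨hF, hfin, hn⟩ := GFGAffineModel.exists_isFreeGroup_puncturedSurfaceGroup hgk
  haveI := hF; haveI := hfin
  exact B.thm26iv_gfg_affine hn hSS hS hSp hj hUo hπc hπs hker hmax
end Punctured

/-! ### The proper GFG carrier: `Γ ≅ S_g`, `g ≥ 2` -/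

section Proper

variable {E : FundamentalExtension.{0}} {Sigma Sigma' : Set ℕ} {Γ : Type} [Group Γ]
  {P : Type} [Group P] [TopologicalSpace P] [IsTopologicalGroup P] [CompactSpace P]
  [TotallyDisconnectedSpace P] {j : Γ →* P} {π : P →* E.geom} {U : Subgroup P}

/-- **[AbsTopI] Thm 2.6 (iv) AT the proper GFG carrier, zero residual binder**: `Δ = E.geom` the Def 2.1 (i)
quotient of a pro-`Σ′` completion of a surface group `S_g`, `g ≥ 2`, MLF base. [cite: MochizukiAbsTopI2012, Thm 2.6 (iv) p.22] -/
theorem MLFBase.thm26iv_gfg (B : E.MLFBase) (hSS : Sigma ⊆ Sigma') (hS : ∃ ℓ ∈ Sigma, ℓ.Prime)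
    (hSp : Sigma ⊆ {q | q.Prime}) {g : ℕ} (hg : 2 ≤ g) (e : Γ ≃* SurfaceGroup g)
    (hj : IsProSigmaCompletion Sigma' j) [U.Normal] (hUo : IsOpen (U : Set P)) (hπc : Continuous π)
    (hπs : Function.Surjective π) (hker : π.ker ≤ U) (hmax : IsMaxProSigmaQuotient Sigma (π.subgroupMap U)) :
    E.Thm26iv Sigma := by
  haveI : CompactSpace E.geom := isCompact_iff_compactSpace.mp E.isClosed_geom.isCompact
  exact B.thm26iv_of_isAlmostPro (prop22_prop23_gfg_mlf B hSS hS (fun _ hp => hSp hp) hg e hj hUo hπc hπs hker hmax).1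
    hSp (GFGSurfaceModel.isAlmostPro hUo hπc hπs hker hmax)

/-- The proper GFG carrier with MLF base lies in the almost pro-`Σ` class (`Σ ⊊ 𝔓𝔯𝔦𝔪𝔢𝔰`); so
`preservesGeom_of_mem_almostProClass` / `thm214GroupPart_of_mem_almostProClass` apply to any pair of GFG carriers
(affine or proper). [cite: MochizukiAbsTopI2012, Def 2.1 (i) p.17] -/
theorem mem_almostProClass_gfg (B : E.MLFBase) (hSS : Sigma ⊆ Sigma') (hS : ∃ ℓ ∈ Sigma, ℓ.Prime)
    (hSp : Sigma ⊆ {q | q.Prime}) (hSne : Sigma ≠ {q | q.Prime}) {g : ℕ} (hg : 2 ≤ g) (e : Γ ≃* SurfaceGroup g)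
    (hj : IsProSigmaCompletion Sigma' j) [U.Normal] (hUo : IsOpen (U : Set P)) (hπc : Continuous π)
    (hπs : Function.Surjective π) (hker : π.ker ≤ U) (hmax : IsMaxProSigmaQuotient Sigma (π.subgroupMap U)) :
    E ∈ {E : FundamentalExtension.{0} | ∃ _B : E.MLFBase, E.GeomTFG ∧
      ∃ S : Set ℕ, S ⊆ {q | q.Prime} ∧ S ≠ {q | q.Prime} ∧ IsAlmostPro E.geom S} := by
  haveI : CompactSpace E.geom := isCompact_iff_compactSpace.mp E.isClosed_geom.isCompact
  exact mem_almostProClass_of_isAlmostPro B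
    (prop22_prop23_gfg_mlf B hSS hS (fun _ hp => hSp hp) hg e hj hUo hπc hπs hker hmax).1 hSp hSne
    (GFGSurfaceModel.isAlmostPro hUo hπc hπs hker hmax)

end Proper

/-! ### Non-vacuity at honest data (product extension over an affine GFG quotient) -/

section NonVacuity

open Field

/-- Transport of `IsMaxProSigmaQuotient` along an isomorphism of topological groups on the TARGET.
[cite: MochizukiAbsTopI2012, Def 2.1 (i) p.17] -/
private theorem isMaxProSigmaQuotient_of_target_continuousMulEquiv {S : Set ℕ} {A Q Q' : Type}
    [Group A] [TopologicalSpace A] [Group Q] [TopologicalSpace Q] [Group Q'] [TopologicalSpace Q']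
    {f : A →* Q} (hf : IsMaxProSigmaQuotient S f) (e : Q ≃ₜ* Q') {f' : A →* Q'} (h : ∀ x, f' x = e (f x)) :
    IsMaxProSigmaQuotient S f' := by
  have hfun : (f' : A → Q') = fun x => e (f x) := funext h
  refine ⟨?_, ?_, hf.proSigma.of_continuousMulEquiv e, ?_⟩
  · rw [hfun]; exact e.continuous.comp hf.continuous
  · intro y
    obtain ⟨x, hx⟩ := hf.surjective (e.symm y)
    exact ⟨x, by rw [h, hx, ContinuousMulEquiv.apply_symm_apply]⟩
  · intro N hN hNo hNi
    have hk : f'.ker = f.ker := by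
      ext x
      rw [MonoidHom.mem_ker, MonoidHom.mem_ker, h, ← map_one e, e.injective.eq_iff]
    rw [hk]
    exact hf.ker_le N hN hNo hNi

/-- **Non-vacuity of the affine GFG-carrier hypotheses at honest data**: for every prime `p`, every pro-`Σ′`
completion `j : Γ → P` of a free group of rank `≥ 2`, every open normal `U ⊴ P` and every `Σ`, there is an
extension `E : FundamentalExtension` with MLF base data (`G = G_{ℚ_p}`) together with a Def 2.1 (i) presentation
`π : P ↠ Δ_E` (`π` continuous surjective, `Ker π = K_Σ(U) ≤ U`, `π|_U` the maximal pro-`Σ` quotient of `U`).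
HONEST LABEL: `Π := (P ⧸ K_Σ(U)) × G_{ℚ_p}`, the PRODUCT (trivial outer Galois action) — a group-theoretic
carrier of the Def 2.1 (i) `Δ`, not the arithmetic fundamental group of a curve over `ℚ_p`; it certifies that
the binders of `MLFBase.thm26iv_gfg_affine` are jointly satisfiable, nothing more.
[cite: MochizukiAbsTopI2012, Def 2.1 (i) p.17] -/
theorem exists_gfg_affine_carrier (p : ℕ) [Fact p.Prime] (Sigma : Set ℕ) {Sigma' : Set ℕ}
    {Γ : Type} [Group Γ] [IsFreeGroup Γ] [Finite (IsFreeGroup.Generators Γ)]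
    {P : Type} [Group P] [TopologicalSpace P] [IsTopologicalGroup P] [CompactSpace P] [TotallyDisconnectedSpace P]
    {j : Γ →* P} (_hj : IsProSigmaCompletion Sigma' j) (U : Subgroup P) [U.Normal] (hUo : IsOpen (U : Set P)) :
    ∃ (E : FundamentalExtension.{0}) (_ : E.MLFBase) (π : P →* E.geom), Continuous π ∧
      Function.Surjective π ∧ π.ker ≤ U ∧ IsMaxProSigmaQuotient Sigma (π.subgroupMap U) := by
  classical
  obtain ⟨K, hKn, hKc, hKU, hmax⟩ := GFGSurfaceModel.exists_gfgQuotient Sigma U hUo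
  haveI := hKn
  haveI : IsClosed ((K : Subgroup P) : Set P) := hKc
  haveI : TotallyDisconnectedSpace (P ⧸ K) := totallyDisconnectedSpace_quotient K hKc
  let E : FundamentalExtension.{0} :=
    { arith := ProfiniteGrp.of ((P ⧸ K) × absoluteGaloisGroup ℚ_[p])
      gal := ProfiniteGrp.of (absoluteGaloisGroup ℚ_[p])
      aug := ⟨MonoidHom.snd (P ⧸ K) (absoluteGaloisGroup ℚ_[p]), continuous_snd⟩
      aug_surjective := fun y => ⟨(1, y), rfl⟩ }
  let B : E.MLFBase := { p := p, K := ℚ_[p], galIso := ContinuousMulEquiv.refl _ }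
  -- `Δ_E = (P ⧸ K) × 1`
  have hmem : ∀ x : P ⧸ K, ((x, (1 : absoluteGaloisGroup ℚ_[p])) : E.arith) ∈ E.geom := fun x => by
    rw [mem_geom]; rfl
  have hsnd : ∀ z : E.geom, (z : E.arith).2 = 1 := fun z => (mem_geom E).mp z.2
  let ι : (P ⧸ K) →* E.geom :=
    { toFun := fun x => ⟨(x, 1), hmem x⟩
      map_one' := rfl
      map_mul' := fun a b => Subtype.ext (Prod.ext rfl (mul_one _).symm) }
  -- the first projection `Δ_E ≅ P ⧸ K`, an isomorphism of topological groups with inverse `ι`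
  let eΔ : E.geom ≃ₜ* (P ⧸ K) :=
    { toFun := fun z => (z : E.arith).1
      invFun := ι
      left_inv := fun z => Subtype.ext (Prod.ext rfl (hsnd z).symm)
      right_inv := fun _ => rfl
      map_mul' := fun _ _ => rfl
      continuous_toFun := continuous_fst.comp continuous_subtype_val
      continuous_invFun := (continuous_id.prodMk continuous_const).subtype_mk _ }
  let π : P →* E.geom := ι.comp (QuotientGroup.mk' K)
  have hπc : Continuous π := eΔ.symm.continuous.comp QuotientGroup.continuous_mk
  have hπs : Function.Surjective π := eΔ.symm.surjective.comp (QuotientGroup.mk'_surjective K)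
  have hπker : π.ker = K := by
    ext x
    rw [MonoidHom.mem_ker, ← QuotientGroup.eq_one_iff x, show π x = eΔ.symm (QuotientGroup.mk' K x) from rfl,
      ← map_one eΔ.symm, eΔ.symm.injective.eq_iff]
    rfl
  -- the restriction `U.map (mk' K) ⥲ U.map π` of `eΔ.symm`
  have hfwd : ∀ y : P ⧸ K, y ∈ U.map (QuotientGroup.mk' K) → ι y ∈ U.map π := by
    rintro y ⟨u, hu, rfl⟩
    exact ⟨u, hu, rfl⟩
  have hbwd : ∀ z : E.geom, z ∈ U.map π → (z : E.arith).1 ∈ U.map (QuotientGroup.mk' K) := by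
    rintro z ⟨u, hu, rfl⟩
    exact ⟨u, hu, rfl⟩
  let eU : (U.map (QuotientGroup.mk' K)) ≃ₜ* (U.map π) :=
    { toFun := fun y => ⟨ι y, hfwd y y.2⟩
      invFun := fun z => ⟨((z : E.geom) : E.arith).1, hbwd z z.2⟩
      left_inv := fun _ => rfl
      right_inv := fun z => Subtype.ext (Subtype.ext (Prod.ext rfl (hsnd z).symm))
      map_mul' := fun _ _ => Subtype.ext (Subtype.ext (Prod.ext rfl (mul_one _).symm))
      continuous_toFun := (eΔ.symm.continuous.comp continuous_subtype_val).subtype_mk _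
      continuous_invFun :=
        (continuous_fst.comp (continuous_subtype_val.comp continuous_subtype_val)).subtype_mk _ }
  have hmaxπ : IsMaxProSigmaQuotient Sigma (π.subgroupMap U) :=
    isMaxProSigmaQuotient_of_target_continuousMulEquiv hmax eU fun _ => rfl
  exact ⟨E, B, π, hπc, hπs, (le_of_eq hπker).trans hKU, hmaxπ⟩

/-- **Hence [AbsTopI] Prop 2.3 (i) and Thm 2.6 (iv) are WITNESSED TOGETHER at a GFG carrier**: for the data of
`exists_gfg_affine_carrier` (`Σ ⊆ Σ′`, `Σ ⊆ 𝔓𝔯𝔦𝔪𝔢𝔰` containing a prime, `Γ` free of rank `≥ 2`), the extension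
`E` produced there has `Δ_E` slim and elastic (so `Δ_E ≠ 1`), almost pro-`Σ`, and satisfies the typed
`E.Thm26iv Σ`. [cite: MochizukiAbsTopI2012, Thm 2.6 (iv) p.22] -/
theorem exists_gfg_affine_carrier_thm26iv (p : ℕ) [Fact p.Prime] {Sigma Sigma' : Set ℕ} (hSS : Sigma ⊆ Sigma')
    (hS : ∃ ℓ ∈ Sigma, ℓ.Prime) (hSp : Sigma ⊆ {q | q.Prime})
    {Γ : Type} [Group Γ] [IsFreeGroup Γ] [Finite (IsFreeGroup.Generators Γ)]
    (hn : 2 ≤ Nat.card (IsFreeGroup.Generators Γ))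
    {P : Type} [Group P] [TopologicalSpace P] [IsTopologicalGroup P] [CompactSpace P] [TotallyDisconnectedSpace P]
    {j : Γ →* P} (hj : IsProSigmaCompletion Sigma' j) (U : Subgroup P) [U.Normal] (hUo : IsOpen (U : Set P)) :
    ∃ (E : FundamentalExtension.{0}) (_ : E.MLFBase) (π : P →* E.geom), Function.Surjective π ∧ π.ker ≤ U ∧
      IsMaxProSigmaQuotient Sigma (π.subgroupMap U) ∧ E.GeomSlimElastic ∧ IsAlmostPro E.geom Sigma ∧
      E.Thm26iv Sigma := by
  obtain ⟨E, B, π, hπc, hπs, hker, hmax⟩ := exists_gfg_affine_carrier p Sigma hj U hUo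
  exact ⟨E, B, π, hπs, hker, hmax, geomSlimElastic_gfg_affine hn hSS hS hj hUo hπc hπs hker hmax,
    isAlmostPro_geom_gfg hUo hπc hπs hker hmax, B.thm26iv_gfg_affine hn hSS hS hSp hj hUo hπc hπs hker hmax⟩

/-- **A fully explicit inhabitant**: `Γ = F₂`, `P` a pro-`Σ′` completion of `F₂`
(`IsProSigmaCompletion.exists_isProSigmaCompletion`), `U = P`, base `G_{ℚ_p}` — an MLF-based extension whose `Δ`
is an (affine) Def 2.1 (i) GFG quotient, slim, elastic, almost pro-`Σ`, satisfying `Thm26iv Σ`, EXISTS for every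
prime `p` and all `Σ ⊆ Σ′` with `Σ ⊆ 𝔓𝔯𝔦𝔪𝔢𝔰` containing a prime. [cite: MochizukiAbsTopI2012, Thm 2.6 (iv) p.22] -/
theorem exists_gfg_affine_model_thm26iv (p : ℕ) [Fact p.Prime] (Sigma Sigma' : Set ℕ) (hSS : Sigma ⊆ Sigma')
    (hS : ∃ ℓ ∈ Sigma, ℓ.Prime) (hSp : Sigma ⊆ {q | q.Prime}) :
    ∃ (E : FundamentalExtension.{0}) (_ : E.MLFBase),
      E.GeomSlimElastic ∧ IsAlmostPro E.geom Sigma ∧ E.Thm26iv Sigma := by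
  classical
  obtain ⟨Q, j, hj⟩ := IsProSigmaCompletion.exists_isProSigmaCompletion (FreeGroup (Fin 2)) Sigma'
  haveI : Finite (IsFreeGroup.Generators (FreeGroup (Fin 2))) :=
    Finite.of_equiv _ (Equiv.ofFreeGroupEquiv (IsFreeGroup.toFreeGroup (FreeGroup (Fin 2))))
  have hn : 2 ≤ Nat.card (IsFreeGroup.Generators (FreeGroup (Fin 2))) := by
    rw [← Nat.card_congr (Equiv.ofFreeGroupEquiv (IsFreeGroup.toFreeGroup (FreeGroup (Fin 2)))), Nat.card_fin]
  obtain ⟨E, B, π, -, -, -, hse, hap, h⟩ :=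
    exists_gfg_affine_carrier_thm26iv p hSS hS hSp hn hj (⊤ : Subgroup Q) isOpen_univ
  exact ⟨E, B, hse, hap, h⟩
end NonVacuity

end FundamentalExtension

end Literature.AnabelianGeometry.AbsoluteAnabelian

end
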